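import Literature.Analysis.FluidPDE.KNSSPlanarVorticity
import Literature.Analysis.FluidPDE.KNSSRegularityProofs
import HarnessLib

/-!
# KNSS 2009, Theorem 5.1 (planar Liouville theorem) from §4 and Lemma 2.1

Analysis/FluidPDE proofs file (theorems only) for the named fact
`Literature.Analysis.FluidPDE.KNSS2009_liouville_planar` (Koch–Nadirashvili–Seregin–Šverák,
Acta Math. 203 (2009) = arXiv:0709.3599, **Theorem 5.1**, p. 9: a bounded weak solution of the
Navier–Stokes equations in `ℝ² × (−∞, 0)` is `u(x, t) = b(t)` with `b` bounded measurable).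

Main result: `Literature.Analysis.FluidPDE.KNSS2009_liouville_planar_of_regularity_of_lemma21`,

  `KNSS2009_regularity_boundedWeak_ancient_planar → KNSS2009_lemma21_halfball ℝ² →
    KNSS2009_liouville_planar`,

i.e. Theorem 5.1 **as printed** follows from the two inputs its printed proof quotes — the §4
regularity of bounded weak solutions (the closing `L^∞` bounds of §4 with Lemma 3.1, and the
planar vorticity equation; named fact of `KNSSRegularityPlanar`) and Lemma 2.1 in the half-ball
form in which the proof uses it (named fact of `KNSSRegularity`, here at `E = ℝ²`) — by the
argument on p. 9:

1. (`curl2_nonpos_of_lemma21`) if a function `f` in the class of Lemma 2.1 is, on every slice, the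
   vorticity `curl2 v` of a `C¹` field bounded by `K`, then `f ≤ 0`: otherwise `M₁ = sup f > 0`,
   Lemma 2.1 yields balls of every radius on which `f ≥ M₁/2` (the volume estimate), and the flux
   bound `∫ ω χ_R ≤ 2K ∫‖Dχ_R‖ = O(R)` (the surface estimate;
   `KNSSPlanarVorticity.false_of_curl2_ge_on_balls`) is contradicted;
2. (`curl2_eq_zero_of_lemma21`) applied to `ω = curl2 U` and to `−ω = curl2 (−U)` (same drift
   `U + b`, the vorticity equation being linear), `ω ≡ 0` on `ℝ² × (−∞, 0)`; the hypotheses of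
   Lemma 2.1 for `ω` (bounds, joint continuity of `Dω`, `Δω`, measurable bounded drift) are read
   off the §4 bounds (`KNSSPlanarVorticity`, `norm_iteratedFDeriv_curl2_le`, time-Lipschitz
   derivatives);
3. (`KNSS2009_liouville_planar_of_regularity_of_lemma21`) each slice `U(t, ·)` is smooth,
   bounded, divergence free and irrotational, hence constant
   (`apply_eq_apply_of_isDivFree_of_curl2_eq_zero`, Liouville), so `u(t, ·) = U(t, 0) + b(t)`
   a.e. for a.e. `t < 0`, with `t ↦ U(t, 0) + b(t)` bounded and measurable.

Since Lemma 2.1 in half-ball form is proved in the tree (`KNSS2009_lemma21_halfball_holds`,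
`KNSSRegularityProofs`, by propagation of positivity with an expanding-ball barrier), the corollary
`Literature.Analysis.FluidPDE.KNSS2009_liouville_planar_of_regularity` reduces Theorem 5.1 to the
§4 regularity fact alone: discharging `KNSS2009_regularity_boundedWeak_ancient_planar` discharges
`KNSS2009_liouville_planar`.

## References

* G. Koch, N. Nadirashvili, G. Seregin, V. Šverák, *Liouville theorems for the Navier–Stokes
  equations and applications*, Acta Math. 203 (2009) 83–105 = arXiv:0709.3599 (page numbers as
  in `KNSSLiouville`): Theorem 5.1 and its proof (p. 9); Lemma 2.1 (p. 5); §4, regularity of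
  bounded weak solutions (p. 8). [KochNadirashviliSereginSverak2009]
-/

noncomputable section

open MeasureTheory Set Function Filter TopologicalSpace InnerProductSpace Metric
open scoped RealInnerProductSpace Laplacian ContDiff Topology NNReal

namespace Literature.Analysis.FluidPDE

/-- Local notation for the plane `ℝ² = EuclideanSpace ℝ (Fin 2)`. -/
local notation "ℝ²" => EuclideanSpace ℝ (Fin 2)

/-! ### Step 1: a vorticity in the class of Lemma 2.1 is nonpositive -/

section Nonpos

/-- **Sup of a vorticity in the class of Lemma 2.1 is `≤ 0`.** Let `f : ℝ → ℝ² → ℝ` satisfy the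
hypotheses of `KNSS2009_lemma21_halfball` on `ℝ² × (−∞, 0)` (bounded, `C²` slices, bounded and
jointly continuous `Df`, `Δf`, the integrated drift–diffusion equation with a bounded measurable
drift `a`), and suppose every slice `f(t, ·)`, `t < 0`, is the vorticity `curl2 v` of some `C¹`
planar field with `‖v‖ ≤ K`. Then `f ≤ 0`. (KNSS 2009, proof of Theorem 5.1, p. 9: if
`M₁ = sup ω > 0`, Lemma 2.1 gives arbitrarily large balls with `ω ≥ M₁/2`, incompatible with the
surface bound `∫_{Q_R} ω ≤ C R³`.) The supremum is handled as `sSup` of the bounded set of values. [cite: KochNadirashviliSereginSverak2009, proof of Thm 5.1 (arXiv p. 9)] -/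
theorem curl2_nonpos_of_lemma21 (h21 : KNSS2009_lemma21_halfball ℝ²) {f : ℝ → ℝ² → ℝ}
    {a : ℝ → ℝ² → ℝ²} {A K : ℝ} (ha : Measurable (uncurry a)) (haA : ∀ t < 0, ∀ y, ‖a t y‖ ≤ A)
    (hfb : ∃ C : ℝ, ∀ t < 0, ∀ y, |f t y| ≤ C) (hf2 : ∀ t < 0, ContDiff ℝ 2 (f t))
    (hfD : ∃ C : ℝ, ∀ t < 0, ∀ y, ‖fderiv ℝ (f t) y‖ ≤ C ∧ |(Δ (f t)) y| ≤ C)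
    (hcD : ContinuousOn (fun p : ℝ × ℝ² => fderiv ℝ (f p.1) p.2) (Iio 0 ×ˢ univ))
    (hcΔ : ContinuousOn (fun p : ℝ × ℝ² => (Δ (f p.1)) p.2) (Iio 0 ×ˢ univ))
    (heq : ∀ y, ∀ s t : ℝ, s ≤ t → t < 0 →
      f t y - f s y = ∫ τ in s..t, ((Δ (f τ)) y - fderiv ℝ (f τ) y (a τ y)))
    (hrep : ∀ t < 0, ∃ v : ℝ² → ℝ², ContDiff ℝ 1 v ∧ (∀ x, ‖v x‖ ≤ K) ∧ f t = curl2 v) :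
    ∀ t < 0, ∀ y, f t y ≤ 0 := by
  by_contra hcon
  push Not at hcon
  obtain ⟨t₀, ht₀, y₀, hy₀⟩ := hcon
  obtain ⟨C, hC⟩ := hfb
  -- the set of values of `f` on the slab, its supremum `M₁`
  set S : Set ℝ := (fun p : ℝ × ℝ² => f p.1 p.2) '' (Iio (0 : ℝ) ×ˢ (univ : Set ℝ²)) with hS
  have hbdd : BddAbove S := by
    refine ⟨C, ?_⟩
    rintro r ⟨⟨t, y⟩, ⟨ht, -⟩, rfl⟩
    exact (le_abs_self _).trans (hC t ht y)
  have hmem : ∀ t < 0, ∀ y, f t y ∈ S := fun t ht y => ⟨(t, y), ⟨ht, mem_univ _⟩, rfl⟩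
  have hne : S.Nonempty := ⟨_, hmem t₀ ht₀ y₀⟩
  set M₁ : ℝ := sSup S with hM₁
  have hle : ∀ t < 0, ∀ y, f t y ≤ M₁ := fun t ht y => le_csSup hbdd (hmem t ht y)
  have hpos : 0 < M₁ := hy₀.trans_le (hle t₀ ht₀ y₀)
  have happ : ∀ ε > 0, ∃ t < 0, ∃ y, M₁ - ε < f t y := by
    intro ε hε
    obtain ⟨r, ⟨⟨t, y⟩, ⟨ht, -⟩, rfl⟩, hr⟩ :=
      exists_lt_of_lt_csSup hne (by linarith : M₁ - ε < sSup S)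
    exact ⟨t, ht, y, hr⟩
  -- Lemma 2.1: half-balls of every radius
  have H := h21 ha haA ⟨C, hC⟩ hf2 hfD hcD hcΔ heq hle happ hpos
  -- the flux bound forbids them
  refine false_of_curl2_ge_on_balls (K := K) (half_pos hpos) fun R hR => ?_
  obtain ⟨y₁, t₁, ht₁, hball⟩ := H R hR
  have ht₂ : t₁ - R ^ 2 / 2 ∈ Ioo (t₁ - R ^ 2) t₁ := by
    constructor <;> nlinarith [sq_nonneg R, hR]
  have ht₂' : t₁ - R ^ 2 / 2 < 0 := by nlinarith [sq_nonneg R]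
  obtain ⟨v, hv, hvK, hfv⟩ := hrep _ ht₂'
  refine ⟨v, y₁, hv, hvK, fun x hx => ?_⟩
  have := hball _ ht₂ x hx
  rwa [hfv] at this

end Nonpos

/-! ### Step 2: the vorticity of the regular representative vanishes -/

section Vorticity

/-- `|Δg(y)| ≤ 2 ‖D²g(y)‖` for a real function on the plane (the Laplacian is the sum of the two
pure second derivatives in an orthonormal frame). [folklore] -/
theorem abs_laplacian_le_two_mul (g : ℝ² → ℝ) (y : ℝ²) :
    |(Δ g) y| ≤ 2 * ‖iteratedFDeriv ℝ 2 g y‖ := by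
  rw [laplacian_eq_iteratedFDeriv_orthonormalBasis g (EuclideanSpace.basisFun (Fin 2) ℝ)]
  simp only [Fin.sum_univ_two]
  have h : ∀ i : Fin 2, |iteratedFDeriv ℝ 2 g y ![EuclideanSpace.basisFun (Fin 2) ℝ i,
      EuclideanSpace.basisFun (Fin 2) ℝ i]| ≤ ‖iteratedFDeriv ℝ 2 g y‖ := by
    intro i
    have := (iteratedFDeriv ℝ 2 g y).le_opNorm
      ![EuclideanSpace.basisFun (Fin 2) ℝ i, EuclideanSpace.basisFun (Fin 2) ℝ i]
    rw [Real.norm_eq_abs] at this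
    refine this.trans ?_
    simp [Fin.prod_univ_two]
  calc |iteratedFDeriv ℝ 2 g y ![_, _] + iteratedFDeriv ℝ 2 g y ![_, _]|
      ≤ |iteratedFDeriv ℝ 2 g y ![_, _]| + |iteratedFDeriv ℝ 2 g y ![_, _]| := abs_add_le _ _
    _ ≤ ‖iteratedFDeriv ℝ 2 g y‖ + ‖iteratedFDeriv ℝ 2 g y‖ := add_le_add (h 0) (h 1)
    _ = 2 * ‖iteratedFDeriv ℝ 2 g y‖ := by ring

variable {U : ℝ → ℝ² → ℝ²}

/-- **Difference bound.** If the `(k+1)`-st derivatives of the smooth slices `U t`, `U s` differ by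
at most `L |t − s|`, then the `k`-th derivatives of their vorticities differ by at most
`‖curl2CLM‖ L |t − s|` (linearity of `curl2` and `norm_iteratedFDeriv_curl2_le`). [folklore] -/
theorem norm_iteratedFDeriv_curl2_sub_le {s t : ℝ} (hs : ContDiff ℝ ∞ (U s))
    (ht : ContDiff ℝ ∞ (U t)) (k : ℕ) {L : ℝ}
    (hL : ∀ x, ‖iteratedFDeriv ℝ (k + 1) (U t) x - iteratedFDeriv ℝ (k + 1) (U s) x‖ ≤
      L * |t - s|) (y : ℝ²) :
    ‖iteratedFDeriv ℝ k (curl2 (U t) - curl2 (U s)) y‖ ≤ ‖curl2CLM‖ * (L * |t - s|) := by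
  have hdiff : curl2 (U t) - curl2 (U s) = curl2 (U t - U s) := by
    funext x
    rw [Pi.sub_apply, curl2_sub (ht.differentiable (by simp) x) (hs.differentiable (by simp) x)]
  rw [hdiff]
  refine (norm_iteratedFDeriv_curl2_le (ht.sub hs) k y).trans ?_
  refine mul_le_mul_of_nonneg_left ?_ (norm_nonneg curl2CLM)
  show ‖iteratedFDeriv ℝ (k + 1) (U t - U s) y‖ ≤ _
  rw [iteratedFDeriv_sub (contDiff_infty.1 ht (k + 1)) (contDiff_infty.1 hs (k + 1))]
  exact hL y

/-- **The vorticity of the §4 representative is in the class of Lemma 2.1 and vanishes.** Let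
`U : ℝ → ℝ² → ℝ²` have smooth slices for `t < 0` with all derivatives bounded uniformly, the
derivatives of order `≥ 1` Lipschitz in `t`, let `U` be jointly measurable, `b` bounded measurable,
and let `ω = curl2 U` satisfy the integrated vorticity equation with drift `U + b` (the clauses of
`KNSS2009_regularity_boundedWeak_ancient_planar`). Under Lemma 2.1 (`KNSS2009_lemma21_halfball ℝ²`),
`ω ≡ 0` on `ℝ² × (−∞, 0)`: `curl2_nonpos_of_lemma21` for `ω = curl2 U` and for `−ω = curl2 (−U)`
(KNSS p. 9: "`M₁ ≤ 0` … In the same way we conclude that `M₂ ≥ 0` and therefore `ω` must vanish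
identically"). [cite: KochNadirashviliSereginSverak2009, proof of Thm 5.1 (arXiv p. 9)] -/
theorem curl2_eq_zero_of_lemma21 (h21 : KNSS2009_lemma21_halfball ℝ²) {b : ℝ → ℝ²}
    (hbm : Measurable b) (hbC : ∃ C : ℝ, ∀ t, ‖b t‖ ≤ C) (hUm : Measurable (uncurry U))
    (hsmooth : ∀ t < 0, ContDiff ℝ ∞ (U t))
    (hbd : ∀ k : ℕ, ∃ C : ℝ, ∀ t < 0, ∀ x, ‖iteratedFDeriv ℝ k (U t) x‖ ≤ C)
    (hlip : ∀ k : ℕ, 1 ≤ k → ∃ L : ℝ, ∀ s < 0, ∀ t < 0, ∀ x,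
      ‖iteratedFDeriv ℝ k (U t) x - iteratedFDeriv ℝ k (U s) x‖ ≤ L * |t - s|)
    (hvort : ∀ x, ∀ s t : ℝ, s ≤ t → t < 0 →
      curl2 (U t) x - curl2 (U s) x =
        ∫ τ in s..t, ((Δ (curl2 (U τ))) x - fderiv ℝ (curl2 (U τ)) x (U τ x + b τ))) :
    ∀ t < 0, ∀ x, curl2 (U t) x = 0 := by
  -- notation
  set ζ : ℝ → ℝ² → ℝ := fun t => curl2 (U t) with hζ
  set a : ℝ → ℝ² → ℝ² := fun t y => U t y + b t with ha
  obtain ⟨Cb, hCb⟩ := hbC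
  obtain ⟨C₀, hC₀⟩ := hbd 0
  obtain ⟨C₁, hC₁⟩ := hbd 1
  obtain ⟨C₂, hC₂⟩ := hbd 2
  obtain ⟨C₃, hC₃⟩ := hbd 3
  obtain ⟨L₂, hL₂⟩ := hlip 2 (by norm_num)
  obtain ⟨L₃, hL₃⟩ := hlip 3 (by norm_num)
  -- the drift
  have ham : Measurable (uncurry a) := by
    have : uncurry a = fun p : ℝ × ℝ² => uncurry U p + b p.1 := by
      funext p; rfl
    rw [this]
    exact hUm.add (hbm.comp measurable_fst)
  have haA : ∀ t < 0, ∀ y, ‖a t y‖ ≤ C₀ + Cb := fun t ht y => by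
    have h0 := hC₀ t ht y
    rw [norm_iteratedFDeriv_zero] at h0
    exact (norm_add_le _ _).trans (add_le_add h0 (hCb t))
  -- the slices of `ζ` are `C²` (indeed smooth)
  have hζ2 : ∀ t < 0, ContDiff ℝ 2 (ζ t) := fun t ht =>
    contDiff_infty.1 (contDiff_curl2_infty (hsmooth t ht)) 2
  -- bounds
  have hζb : ∀ t < 0, ∀ y, |ζ t y| ≤ ‖curl2CLM‖ * C₁ := fun t ht y => by
    refine (abs_curl2_le (U t) y).trans (mul_le_mul_of_nonneg_left ?_ (norm_nonneg curl2CLM))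
    rw [← norm_iteratedFDeriv_one]
    exact hC₁ t ht y
  have hζD : ∀ t < 0, ∀ y, ‖fderiv ℝ (ζ t) y‖ ≤ ‖curl2CLM‖ * C₂ := fun t ht y => by
    rw [← norm_iteratedFDeriv_one]
    exact (norm_iteratedFDeriv_curl2_le (hsmooth t ht) 1 y).trans
      (mul_le_mul_of_nonneg_left (hC₂ t ht y) (norm_nonneg curl2CLM))
  have hζΔ : ∀ t < 0, ∀ y, |(Δ (ζ t)) y| ≤ 2 * (‖curl2CLM‖ * C₃) := fun t ht y => by
    refine (abs_laplacian_le_two_mul (ζ t) y).trans (mul_le_mul_of_nonneg_left ?_ two_pos.le)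
    exact (norm_iteratedFDeriv_curl2_le (hsmooth t ht) 2 y).trans
      (mul_le_mul_of_nonneg_left (hC₃ t ht y) (norm_nonneg curl2CLM))
  have hfD : ∃ C : ℝ, ∀ t < 0, ∀ y, ‖fderiv ℝ (ζ t) y‖ ≤ C ∧ |(Δ (ζ t)) y| ≤ C :=
    ⟨max (‖curl2CLM‖ * C₂) (2 * (‖curl2CLM‖ * C₃)), fun t ht y =>
      ⟨(hζD t ht y).trans (le_max_left _ _), (hζΔ t ht y).trans (le_max_right _ _)⟩⟩
  -- time-Lipschitz bounds for `Dζ` and `Δζ`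
  have hDlip : ∀ s < 0, ∀ t < 0, ∀ y,
      ‖fderiv ℝ (ζ t) y - fderiv ℝ (ζ s) y‖ ≤ ‖curl2CLM‖ * (L₂ * |t - s|) := by
    intro s hs t ht y
    have h := norm_iteratedFDeriv_curl2_sub_le (hsmooth s hs) (hsmooth t ht) 1 (hL₂ s hs t ht) y
    rw [norm_iteratedFDeriv_one] at h
    rwa [← fderiv_sub ((hζ2 t ht).differentiable two_ne_zero y)
      ((hζ2 s hs).differentiable two_ne_zero y)]
  have hΔlip : ∀ s < 0, ∀ t < 0, ∀ y,
      |(Δ (ζ t)) y - (Δ (ζ s)) y| ≤ 2 * (‖curl2CLM‖ * (L₃ * |t - s|)) := by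
    intro s hs t ht y
    have h := norm_iteratedFDeriv_curl2_sub_le (hsmooth s hs) (hsmooth t ht) 2 (hL₃ s hs t ht) y
    rw [← (hζ2 t ht).contDiffAt.laplacian_sub (hζ2 s hs).contDiffAt]
    exact (abs_laplacian_le_two_mul _ y).trans (mul_le_mul_of_nonneg_left h two_pos.le)
  -- joint continuity of `Dζ` and `Δζ` on the slab
  have hcD : ContinuousOn (fun p : ℝ × ℝ² => fderiv ℝ (ζ p.1) p.2) (Iio 0 ×ˢ univ) := by
    refine continuousOn_prod_of_continuousOn_lipschitzOnWith _ (Real.toNNReal (‖curl2CLM‖ * L₂))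
      (fun t ht => ?_) (fun y _ => ?_)
    · exact (((hζ2 t ht).continuous_fderiv two_ne_zero)).continuousOn
    · refine LipschitzOnWith.of_dist_le' fun t ht s hs => ?_
      rw [dist_eq_norm, Real.dist_eq]
      simpa [mul_assoc] using hDlip s hs t ht y
  have hcΔ : ContinuousOn (fun p : ℝ × ℝ² => (Δ (ζ p.1)) p.2) (Iio 0 ×ˢ univ) := by
    refine continuousOn_prod_of_continuousOn_lipschitzOnWith _
      (Real.toNNReal (2 * (‖curl2CLM‖ * L₃))) (fun t ht => ?_) (fun y _ => ?_)
    · exact (continuous_laplacian (hζ2 t ht)).continuousOn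
    · refine LipschitzOnWith.of_dist_le' fun t ht s hs => ?_
      rw [Real.dist_eq, Real.dist_eq]
      simpa [mul_assoc] using hΔlip s hs t ht y
  -- `ζ ≤ 0`
  have hrep : ∀ t < 0, ∃ v : ℝ² → ℝ², ContDiff ℝ 1 v ∧ (∀ x, ‖v x‖ ≤ C₀) ∧ ζ t = curl2 v :=
    fun t ht => ⟨U t, contDiff_infty.1 (hsmooth t ht) 1, fun x => by
      simpa [norm_iteratedFDeriv_zero] using hC₀ t ht x, rfl⟩
  have hle : ∀ t < 0, ∀ y, ζ t y ≤ 0 :=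
    curl2_nonpos_of_lemma21 h21 ham haA ⟨_, hζb⟩ hζ2 hfD hcD hcΔ hvort hrep
  -- `−ζ ≤ 0`: the same for `−ζ = curl2 (−U)` with the same drift
  set ζ' : ℝ → ℝ² → ℝ := fun t => -(ζ t) with hζ'
  have hζ'2 : ∀ t < 0, ContDiff ℝ 2 (ζ' t) := fun t ht => (hζ2 t ht).neg
  have hζ'b : ∃ C : ℝ, ∀ t < 0, ∀ y, |ζ' t y| ≤ C :=
    ⟨‖curl2CLM‖ * C₁, fun t ht y => by simpa [hζ', abs_neg] using hζb t ht y⟩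
  have hζ'D : ∃ C : ℝ, ∀ t < 0, ∀ y, ‖fderiv ℝ (ζ' t) y‖ ≤ C ∧ |(Δ (ζ' t)) y| ≤ C := by
    obtain ⟨C, hC⟩ := hfD
    refine ⟨C, fun t ht y => ?_⟩
    simp only [hζ', fderiv_neg, norm_neg, laplacian_neg, Pi.neg_apply, abs_neg]
    exact hC t ht y
  have hc'D : ContinuousOn (fun p : ℝ × ℝ² => fderiv ℝ (ζ' p.1) p.2) (Iio 0 ×ˢ univ) := by
    have : (fun p : ℝ × ℝ² => fderiv ℝ (ζ' p.1) p.2) = fun p => -fderiv ℝ (ζ p.1) p.2 := by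
      funext p; simp [hζ', fderiv_neg]
    rw [this]
    exact hcD.neg
  have hc'Δ : ContinuousOn (fun p : ℝ × ℝ² => (Δ (ζ' p.1)) p.2) (Iio 0 ×ˢ univ) := by
    have : (fun p : ℝ × ℝ² => (Δ (ζ' p.1)) p.2) = fun p => -(Δ (ζ p.1)) p.2 := by
      funext p; simp [hζ', laplacian_neg]
    rw [this]
    exact hcΔ.neg
  have heq' : ∀ y, ∀ s t : ℝ, s ≤ t → t < 0 →
      ζ' t y - ζ' s y = ∫ τ in s..t, ((Δ (ζ' τ)) y - fderiv ℝ (ζ' τ) y (a τ y)) := by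
    intro y s t hst ht
    have h := hvort y s t hst ht
    have hpt : (fun τ => (Δ (ζ' τ)) y - fderiv ℝ (ζ' τ) y (a τ y)) =
        fun τ => -((Δ (ζ τ)) y - fderiv ℝ (ζ τ) y (a τ y)) := by
      funext τ
      have h1 : Δ (ζ' τ) = -(Δ (ζ τ)) := by rw [hζ']; exact laplacian_neg
      have h2 : fderiv ℝ (ζ' τ) y = -fderiv ℝ (ζ τ) y := by rw [hζ']; exact fderiv_neg
      rw [h1, h2]
      simp only [Pi.neg_apply, neg_apply]
      ring
    rw [hpt, intervalIntegral.integral_neg, ← h]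
    show -(ζ t y) - -(ζ s y) = -(curl2 (U t) y - curl2 (U s) y)
    simp only [hζ]
    ring
  have hrep' : ∀ t < 0, ∃ v : ℝ² → ℝ², ContDiff ℝ 1 v ∧ (∀ x, ‖v x‖ ≤ C₀) ∧ ζ' t = curl2 v :=
    fun t ht => ⟨fun y => -U t y, (contDiff_infty.1 (hsmooth t ht) 1).neg,
      fun x => by simpa [norm_iteratedFDeriv_zero, norm_neg] using hC₀ t ht x, by
        show -(curl2 (U t)) = _
        rw [curl2_fun_neg]
        rfl⟩
  have hle' : ∀ t < 0, ∀ y, ζ' t y ≤ 0 :=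
    curl2_nonpos_of_lemma21 h21 ham haA hζ'b hζ'2 hζ'D hc'D hc'Δ heq' hrep'
  -- conclude
  intro t ht x
  have h1 := hle t ht x
  have h2 := hle' t ht x
  simp only [hζ', Pi.neg_apply, neg_nonpos] at h2
  exact le_antisymm h1 h2

end Vorticity

/-! ### Step 3: Theorem 5.1 from the two named facts -/

section Main

/-- **KNSS 2009, Theorem 5.1, from §4 and Lemma 2.1.** Assume the planar §4 regularity of bounded
weak solutions (`KNSS2009_regularity_boundedWeak_ancient_planar`) and Lemma 2.1 in half-ball form
on `ℝ²` (`KNSS2009_lemma21_halfball`). Then every bounded weak solution `u` of the Navier–Stokes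
equations in `ℝ² × (−∞, 0)` is `u(t, ·) = b(t)` a.e. in `x` for a.e. `t < 0`, with `b` bounded
measurable (`KNSS2009_liouville_planar`, the theorem as printed). Proof as printed (p. 9): with
`u = U + b(t)` the regular representative, the vorticity `ω = curl2 U` vanishes identically
(`curl2_eq_zero_of_lemma21`: Lemma 2.1 against the flux bound), so each slice `U(t, ·)` — smooth,
bounded, `div U = 0`, `curl U = 0` — is constant by Liouville's theorem
(`apply_eq_apply_of_isDivFree_of_curl2_eq_zero`), and `u(t, ·) = U(t, 0) + b(t)` a.e.; the
function `t ↦ U(t, 0) + b(t)` (extended by `0` to `t ≥ 0`) is measurable and bounded. [cite: KochNadirashviliSereginSverak2009, Thm 5.1 and its proof (arXiv p. 9)] -/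
theorem KNSS2009_liouville_planar_of_regularity_of_lemma21
    (hreg : KNSS2009_regularity_boundedWeak_ancient_planar)
    (h21 : KNSS2009_lemma21_halfball ℝ²) : KNSS2009_liouville_planar := by
  intro u hu
  obtain ⟨U, b, hbm, hbC, hUm, hae, hsmooth, hdiv, hbd, hlip, hvort⟩ := hreg hu
  -- the vorticity vanishes
  have hω0 : ∀ t < 0, ∀ x, curl2 (U t) x = 0 :=
    curl2_eq_zero_of_lemma21 h21 hbm hbC hUm hsmooth hbd hlip hvort
  -- every slice is constant
  obtain ⟨C₀, hC₀⟩ := hbd 0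
  have hC₀' : ∀ t < 0, ∀ x, ‖U t x‖ ≤ C₀ := fun t ht x => by
    simpa [norm_iteratedFDeriv_zero] using hC₀ t ht x
  have hconst : ∀ t < 0, ∀ x, U t x = U t 0 := fun t ht x =>
    apply_eq_apply_of_isDivFree_of_curl2_eq_zero (contDiff_infty.1 (hsmooth t ht) 2)
      (hdiv t ht) (hω0 t ht) (hC₀' t ht) x 0
  -- the bounded measurable `b(t)` of the statement
  obtain ⟨Cb, hCb⟩ := hbC
  refine ⟨fun t => if t < 0 then U t 0 + b t else 0, ?_, ⟨C₀ + Cb, fun t => ?_⟩, ?_⟩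
  · refine Measurable.ite measurableSet_Iio ?_ measurable_const
    exact (hUm.comp (measurable_id.prodMk measurable_const)).add hbm
  · have hCb0 : 0 ≤ Cb := (norm_nonneg _).trans (hCb 0)
    dsimp only
    split_ifs with ht
    · exact (norm_add_le _ _).trans (add_le_add (hC₀' t ht 0) (hCb t))
    · have hC₀0 : 0 ≤ C₀ := (norm_nonneg _).trans (hC₀' (-1) (by norm_num) 0)
      simpa using add_nonneg hC₀0 hCb0
  · filter_upwards [hae, ae_restrict_mem measurableSet_Iio] with t ht htneg
    filter_upwards [ht] with x hx
    rw [hx, hconst t htneg x]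
    simp [mem_Iio.1 htneg]

/-- **KNSS 2009, Theorem 5.1 from the §4 regularity fact alone.** Lemma 2.1 in half-ball form
being proved (`KNSS2009_lemma21_halfball_holds`), the theorem as printed,
`KNSS2009_liouville_planar`, follows from `KNSS2009_regularity_boundedWeak_ancient_planar`; its
trust base is that single named fact (KNSS §4 with Lemma 3.1). [cite: KochNadirashviliSereginSverak2009, Thm 5.1 (arXiv p. 9)] -/
theorem KNSS2009_liouville_planar_of_regularity
    (hreg : KNSS2009_regularity_boundedWeak_ancient_planar) : KNSS2009_liouville_planar :=
  KNSS2009_liouville_planar_of_regularity_of_lemma21 hreg KNSS2009_lemma21_halfball_holds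

end Main

end Literature.Analysis.FluidPDE

end
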